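import Literature.AlgebraicGeometry.ShimuraVarieties.UnitaryShimuraCurveRecordMorphisms
import Literature.AlgebraicGeometry.ShimuraVarieties.UnitaryShimuraCurveLevelFibres
import Literature.AlgebraicGeometry.Motives.AbelianVarietyEpiTateSurjective
import Literature.NumberTheory.Automorphic.Liu2021.AlbaneseExistence
import Literature.NumberTheory.Automorphic.Liu2021.NablaMapSurjectiveOfPieces
import Literature.NumberTheory.Automorphic.Liu2021.AppendixC.AlbaneseFunctorial
import Literature.NumberTheory.Automorphic.Liu2021.AppendixC.Sec42DataCompactCase
import Literature.NumberTheory.Automorphic.Liu2021.AppendixC.IsogenyDescentOfLevelQuotientHolds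
import Literature.NumberTheory.Automorphic.Liu2021.AppendixC.EtaleHeckeDatumOfTranslates
import HarnessLib

/-!
# Liu 2021 §4.2 / App. C for the record curve: the UNTWISTED canonical-model tower `K ↦ M⋆_K` of the unitary Shimura curve
# `Sh(U(J⋆))` as an honest §4.2 datum — `honestSystemGSM`, `sec42DataGSM`, its OWN Hecke translates and étale Hecke datum
# (Literature port (P) of the Summits-side `CorCM/HypLiu418/A3Liu418GSConjugateTransport.lean` §1/§1′; DRAFT — NOT FILED this run)

Cell `hodgecm-mathlib` (D-0151); A-plan2 (g12) 02:00:52Z «(P) FULL-PORT DRAFT HOME-only»; A-p15 (g11)'s census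
`CENSUS-RecordCurveLayer-port.A-p15g11.md` (9a7f8495) §1 items 1–3 and 5; director s206 «next run».  Everything here is a
RESTATEMENT over an UNBUNDLED CM field `(F : Type) [Field F] [NumberField F] [IsCMField F]` of declarations that are GREEN on the
Summits side over the bundled `CMField` (A-p13 (g18), S34 ed.3 8050a5fe/af213fd5 §1/§1′; TEAM hComp (U2) `HonestP5.lean` :122–150;
`HonestP5OfNonVacuity.lean` :101–107; `A3Liu418GSInstance.lean` :157–168), with Literature-only imports, so that the printed FACT
[Liu2021, Cor. D.9] for the curve `M⋆` can be TYPED under `Literature/` at `CM := sec42DataGSM`, `XM := etaleHeckeDatumGSM` (road (P) of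
the census; the companion scratch `RecordCurveSec42Datum.rflcheck.A-p12g9.lean` identifies the Summits and Literature copies by `rfl`).
DEFINITIONS WITH BODIES + theorems; no named fact, no instance, no notation, no `sorry`; hypotheses exactly {`S`, u1 `hU7ₛ`, u4 `hLQ`,
`h4 : 4 ≤ [F:ℚ]`, `isoₛ`}.  HC_CM is proved only modulo the 7 printed citations until rung 0 closes; nothing of [Liu2021] is asserted.

## PASTE NOTE
§P below is the body of `RecordCurveP5.draft.A-p12g9.lean` (2a26542d; → `AppendixC/RecordCurveP5.lean`, road (P′)) VERBATIM; when that
file is in the tree, §P is replaced by `import Literature.NumberTheory.Automorphic.Liu2021.AppendixC.RecordCurveP5`.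

* §P  `restrictLevel`, `restrictFunctor`, `honestP5GSM` (P′, verbatim).
* §A  index plumbing, remainder of TEAM hComp (U2): `val_transport_refl`, `smallLevelIsoOfValEq`, `restrictTransportIso`,
      `transportRestrictIso`, `restrictIsoOfLe`.
* §B  `finrank_maximalRealSubfield_ne_one` (`[F⁺:ℚ] ≠ 1` when `4 ≤ [F:ℚ]`: the curve is in Liu's Compact Case, §4.2 l. 2055–2060).
* §C  `honestSystemGSM` (Prop. C.5 constructed), `smooth_/projective_honestSystemGSM_Sh`, `compactifiedOfGSM` (Def. C.8, Compact Case),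
      `isProjectiveOver_honestSystemGSM_Sh_iff`, **`sec42DataGSM S h4 iso : Sec42Data (honestP5GSM F Jstar K₀ S.M) iso`**, `sec42DataGSM_X`.
* §D  `recordHeckeTranslateGS` / `isHeckeTranslate_recordHeckeTranslateGS` (u1's chosen translates), `heckeTranslatesGSM`,
      `sec42HeckeTranslatesGSM` (`_tr`), `albTransitionEpi_GSM`, `hI_GSM`, `levelQuotientUP_GSM`, `isogenyDescent_GSM`,
      **`etaleHeckeDatumGSM S hU7ₛ hLQ h4 isoₛ ℓ : (sec42DataGSM S h4 isoₛ).EtaleHeckeDatum ℓ`**, `isInducedBy_`/`rhoEt_etaleHeckeDatumGSM`.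

References: [Liu2021] Y. Liu, Camb. J. Math. 9 (2021) = arXiv:2102.11518, §4.2 (l. 2053–2074), App. C Def. C.3–C.8, Prop. C.5,
proof of Thm. 4.15 (l. 2193–2208), App. D Cor. D.9; [Deligne1979ShimuraVarieties] 2.1.2–2.1.4, 2.7.1; [Milne2005ShimuraVarieties]
Thm. 13.6, Rem. 5.29, Def. 12.10.
-/

set_option autoImplicit false

noncomputable section

namespace Literature.NumberTheory.Automorphic.Liu2021.AppendixC

open CategoryTheory CategoryTheory.Limits _root_.AlgebraicGeometry _root_.NumberField
open Literature.AlgebraicGeometry.Motives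
open Literature.AlgebraicGeometry.ShimuraVarieties.UnitaryCanonicalModel
open Literature.NumberTheory.Automorphic Literature.NumberTheory.Automorphic.UnitaryGroup

/-! ## §P — PASTE of `RecordCurveP5.draft.A-p12g9.lean` (road (P′)), verbatim -/

/-! ## §1 Index plumbing: `K ↦ K ⊓ K₀` -/

section Index

variable {H : Type} [Group H] [TopologicalSpace H] [IsTopologicalGroup H] (K₀ : C5.OpenCompactSubgroup H)

/-- `K ↦ K ⊓ K₀`: an open compact subgroup restricted below the threshold `K₀` (an intersection of open compact subgroups
is open compact).  Liu indexes `Sh(𝕍)_K` by «sufficiently small open compact subgroups `K`» ([Liu2021] Prop. C.5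
l. 4627–4628, READING R2 of `PropC5.lean`: the `K ⊆ K₀`), while the carrier `PropC5Data.Sh τ τ'` is indexed by ALL open
compact `K`; this restriction extends a system given below `K₀` to all `K`, with values that are never used above `K₀`.
Ours (bookkeeping; Literature copy of the TEAM hComp (U2) declaration). [cite: Liu2021, Prop. C.5 l. 4627–4628] -/
def restrictLevel (K : C5.OpenCompactSubgroup H) : C5.SmallLevel K₀ :=
  ⟨⟨K.1 ⊓ K₀.1,
    ⟨by simpa only [Subgroup.coe_inf] using K.2.1.inter K₀.2.1,
     by simpa only [Subgroup.coe_inf] using K₀.2.2.inter_left (Subgroup.isClosed_of_isOpen _ K.2.1)⟩⟩,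
   (inf_le_right : K.1 ⊓ K₀.1 ≤ K₀.1)⟩

/-- The underlying subgroup of `restrictLevel K₀ K` is `K ⊓ K₀`. [cite: Liu2021, Prop. C.5 l. 4627–4628] -/
@[simp] theorem restrictLevel_val_val (K : C5.OpenCompactSubgroup H) :
    ((restrictLevel K₀ K).1.1 : Subgroup H) = K.1 ⊓ K₀.1 := rfl

/-- `K ↦ K ⊓ K₀` is monotone. [cite: Liu2021, Prop. C.5 l. 4627–4628] -/
theorem restrictLevel_mono : Monotone (restrictLevel K₀) :=
  fun _ _ h => (inf_le_inf_right K₀.1 h : _ ⊓ K₀.1 ≤ _ ⊓ K₀.1)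

/-- `K ↦ K ⊓ K₀` as a functor from all open compact subgroups (inclusion order) to the sufficiently small ones.
[cite: Liu2021, Prop. C.5 l. 4627–4628] -/
def restrictFunctor : C5.OpenCompactSubgroup H ⥤ C5.SmallLevel K₀ :=
  Monotone.functor (f := restrictLevel K₀) (restrictLevel_mono K₀)

end Index

/-! ## §2 The honest Prop-C.5 datum of the record curve tower -/

section RecordCurve

variable (F : Type) [Field F] [NumberField F] [IsCMField F] (Jstar : Matrix (Fin 2) (Fin 2) F)
  (K₀ : C5.OpenCompactSubgroup ↥(finAdelic (↥(maximalRealSubfield F)) F (IsCMField.complexConj F) 2 Jstar))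
  (M : C5.SmallLevel K₀ ⥤ SchemeOver F)

/-- **The honest Prop-C.5 datum of the curve `U(J⋆)` with the UNTWISTED tower**: rank `n = 2`, `𝕍 = 𝔸_{F,f}²`,
`𝔾(𝔸_F^∞) = G(τ)(𝔸^∞) = U(J⋆)(𝔸_{F⁺,f})`, all fixed isomorphisms the identity, and
`Sh τ τ' := K ↦ M_{K ⊓ K₀} ⊗_{F,τ'} τ'(F)` for a tower `M` on the sufficiently small levels (for the record curve:
`M := RecordSystemGS.M`).  Literature copy, over an unbundled CM field, of A-p13 (g18)'s Summits-side `honestP5GSM`.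
[cite: Liu2021, App. C Def. C.3–C.4 (l. 4614–4624) and Prop. C.5 (l. 4627–4637)] -/
abbrev honestP5GSM : PropC5Data (↥(maximalRealSubfield F)) F where
  n := 2
  one_le_n := by norm_num
  𝕍 := Fin 2 → IsDedekindDomain.FiniteAdeleRing (𝓞 F) F
  G := ↥(finAdelic (↥(maximalRealSubfield F)) F (IsCMField.complexConj F) 2 Jstar)
  V := fun _ => Fin 2 → F
  Gτ := fun _ => ↥(finAdelic (↥(maximalRealSubfield F)) F (IsCMField.complexConj F) 2 Jstar)
  fix := fun _ => ContinuousMulEquiv.refl _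
  Sh := fun _ τ' => restrictFunctor K₀ ⋙ M ⋙ C5.baseChangeAlong τ'.rangeRestrictField

/-- The rank of `honestP5GSM` is `2` (`rfl`). [cite: Liu2021, App. C Def. C.3 (l. 4614)] -/
theorem honestP5GSM_n : (honestP5GSM F Jstar K₀ M).n = 2 := rfl

/-- The Shimura-variety slot of `honestP5GSM` is `K ↦ M_{K ⊓ K₀} ⊗_{F,τ'} τ'(F)` (`rfl`). [cite: Liu2021, App. C Prop. C.5 (l. 4627–4637)] -/
theorem honestP5GSM_Sh (τ : ↥(maximalRealSubfield F) →+* ℝ) (τ' : F →+* ℂ) :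
    (honestP5GSM F Jstar K₀ M).Sh τ τ' = restrictFunctor K₀ ⋙ M ⋙ C5.baseChangeAlong τ'.rangeRestrictField := rfl

end RecordCurve


/-! ## §A Index plumbing, remainder (TEAM hComp (U2) `HonestP5.lean` :122–160, verbatim) -/

section IndexMore

variable {H : Type} [Group H] [TopologicalSpace H] [IsTopologicalGroup H] (K₀ : C5.OpenCompactSubgroup H)

omit [IsTopologicalGroup H] in
/-- Transport along the identity isomorphism `𝔾(𝔸_F^∞) ≃ G(τ)(𝔸^∞) := refl` does not move a level («regard `K` as a subgroup
of `G(τ)(𝔸^∞)`», [Liu2021] l. 4632, when the fixed isomorphism is the identity).  Genuine restatement, for the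
Literature layer, of the Summits-side `Summit.HodgeConjecture.CorCM.Model.HComp.val_transport_refl`
(`Summits/HodgeConjecture/CorCM/B01/Transposition/HComp/HonestP5.lean`, TEAM hComp (U2)) — same statement, cited here on
purpose (a Literature file cannot import a Summits module). [cite: Liu2021, Prop. C.5 l. 4632] -/
@[simp] private theorem val_transport_refl (K : C5.OpenCompactSubgroup H) :
    (C5.OpenCompactSubgroup.transport (ContinuousMulEquiv.refl H) K).1 = K.1 :=
  SetLike.coe_injective (by
    rw [C5.OpenCompactSubgroup.coe_transport, ContinuousMulEquiv.coe_refl, Set.image_id])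

/-- In the index preorder `C5.SmallLevel K₀`, two levels with the same underlying subgroup are isomorphic (the preorder is
the inclusion of underlying subgroups). Ours (bookkeeping). [cite: Liu2021, Prop. C.5 l. 4627–4628] -/
def smallLevelIsoOfValEq (K K' : C5.SmallLevel K₀) (h : (K.1.1 : Subgroup H) = K'.1.1) : K ≅ K' where
  hom := homOfLE (show K.1.1 ≤ K'.1.1 from h.le)
  inv := homOfLE (show K'.1.1 ≤ K.1.1 from h.ge)
  hom_inv_id := Subsingleton.elim _ _
  inv_hom_id := Subsingleton.elim _ _

/-- For `K ≤ K₀`: restricting the identity-transported `K` below `K₀` gives back `K` (up to the unique isomorphism of the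
index preorder): `(refl K) ⊓ K₀ = K`. [cite: Liu2021, Prop. C.5 l. 4627–4632] -/
def restrictTransportIso (K : C5.OpenCompactSubgroup H) (hK : K ≤ K₀) :
    restrictLevel K₀ (C5.OpenCompactSubgroup.transport (ContinuousMulEquiv.refl H) K) ≅ (⟨K, hK⟩ : C5.SmallLevel K₀) :=
  smallLevelIsoOfValEq K₀ _ _ (by
    rw [restrictLevel_val_val, val_transport_refl]
    exact inf_eq_left.2 hK)

/-- Below `K₀`, «transport along the identity, then restrict below `K₀`» is the identity functor of the index preorder, up
to a (unique) natural isomorphism. [cite: Liu2021, Prop. C.5 l. 4627–4632] -/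
def transportRestrictIso :
    C5.SmallLevel.transport (ContinuousMulEquiv.refl H) K₀ ⋙ restrictFunctor K₀ ≅ 𝟭 (C5.SmallLevel K₀) :=
  NatIso.ofComponents (fun K => restrictTransportIso K₀ K.1 K.2) (fun _ => Subsingleton.elim _ _)

/-- For `K ≤ K₀`: `K ⊓ K₀ = K` in the index preorder (up to its unique isomorphism). [cite: Liu2021, Prop. C.5 l. 4627–4628] -/
def restrictIsoOfLe (K : C5.OpenCompactSubgroup H) (hK : K ≤ K₀) :
    restrictLevel K₀ K ≅ (⟨K, hK⟩ : C5.SmallLevel K₀) :=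
  smallLevelIsoOfValEq K₀ _ _ (by rw [restrictLevel_val_val]; exact inf_eq_left.2 hK)

end IndexMore

/-! ## §B The Compact-Case arithmetic -/

/-- `d = [F⁺:ℚ] ≠ 1` for a CM field with `4 ≤ [F:ℚ]` (`[F:ℚ] = 2·[F⁺:ℚ]`): the record curve is in Liu's Compact Case
([Liu2021] §4.2 l. 2055–2057). [cite: Liu2021, §4.2 l. 2053–2057] -/
theorem finrank_maximalRealSubfield_ne_one {F : Type} [Field F] [NumberField F] [IsCMField F]
    (h4 : 4 ≤ Module.finrank ℚ F) : Module.finrank ℚ (maximalRealSubfield F) ≠ 1 := by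
  intro h1
  have hmul := Module.finrank_mul_finrank ℚ (maximalRealSubfield F) F
  rw [Algebra.IsQuadraticExtension.finrank_eq_two (maximalRealSubfield F) F, h1] at hmul
  omega

/-! ## §C Prop. C.5 and the §4.2 datum for the untwisted tower -/

section HonestSystem

variable {F : Type} [Field F] [NumberField F] [IsCMField F] {ι₁ : F →+* ℂ} (Jstar : Matrix (Fin 2) (Fin 2) F)
  (K₀ : C5.OpenCompactSubgroup ↥(finAdelic (↥(maximalRealSubfield F)) F (IsCMField.complexConj F) 2 Jstar))
  (M : C5.SmallLevel K₀ ⥤ SchemeOver F)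

/-- **Prop. C.5 CONSTRUCTED on `honestP5GSM`**: threshold `K₀`, `Sh(𝕍) := M`, and the isomorphisms
`Sh(𝕍)_K ⊗_{F,τ'} τ'(F) ≅ Sh τ τ' (transport refl K) = M_{K ⊓ K₀} ⊗ τ'(F)` from `K ⊓ K₀ = K` (`transportRestrictIso`).
[cite: Liu2021, App. C Prop. C.5 (l. 4627–4637)] -/
abbrev honestSystemGSM : IncoherentShimuraSystem (honestP5GSM F Jstar K₀ M) where
  K₀ := K₀
  Sh𝕍 := M
  iso _ τ' _ :=
    (Functor.leftUnitor (M ⋙ C5.baseChangeAlong τ'.rangeRestrictField)).symm ≪≫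
      Functor.isoWhiskerRight (transportRestrictIso K₀).symm (M ⋙ C5.baseChangeAlong τ'.rangeRestrictField) ≪≫
      Functor.associator _ _ _

variable {Jstar K₀} (S : RecordSystemGS F Jstar ι₁ K₀)

/-- `M⋆_K` is smooth of relative dimension `1 = n - 1`. [cite: Liu2021, App. C Prop. C.5 and l. 4656] -/
theorem smooth_honestSystemGSM_Sh (K : C5.SmallLevel (honestSystemGSM Jstar K₀ S.M).K₀) :
    SmoothOfRelativeDimension ((honestP5GSM F Jstar K₀ S.M).n - 1) ((honestSystemGSM Jstar K₀ S.M).Sh𝕍.obj K).hom :=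
  S.smooth K

/-- `M⋆_K` is projective. [cite: Liu2021, App. C Prop. C.5 and l. 4656] -/
theorem projective_honestSystemGSM_Sh (K : C5.SmallLevel (honestSystemGSM Jstar K₀ S.M).K₀) :
    IsProjectiveOver ((honestSystemGSM Jstar K₀ S.M).Sh𝕍.obj K) :=
  S.projective K

/-- Def. C.8 in the Compact Case for the untwisted tower: `X := M⋆`, identity comparison maps. [cite: Liu2021, App. C Def. C.8 (l. 4663–4665)] -/
def compactifiedOfGSM : CompactifiedSystem (honestSystemGSM Jstar K₀ S.M) :=
  CompactifiedSystem.ofProjective (honestSystemGSM Jstar K₀ S.M) (smooth_honestSystemGSM_Sh S) (projective_honestSystemGSM_Sh S)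

/-- The projectivity clause of `Sec42Data` at `n = 2` for the untwisted tower: both sides hold when `4 ≤ [F:ℚ]`.
[cite: Liu2021, §4.2 l. 2053–2060] -/
theorem isProjectiveOver_honestSystemGSM_Sh_iff (h4 : 4 ≤ Module.finrank ℚ F) (iso : ℕ → Prop)
    (K : C5.SmallLevel (honestSystemGSM Jstar K₀ S.M).K₀) :
    IsProjectiveOver ((honestSystemGSM Jstar K₀ S.M).Sh𝕍.obj K) ↔
      ¬ (Module.finrank ℚ (maximalRealSubfield F) = 1 ∧
        (3 ≤ (honestP5GSM F Jstar K₀ S.M).n ∨ ((honestP5GSM F Jstar K₀ S.M).n = 2 ∧ ∀ p : ℕ, p.Prime → iso p))) :=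
  ⟨fun _ hh => finrank_maximalRealSubfield_ne_one h4 hh.1, fun _ => projective_honestSystemGSM_Sh S K⟩

/-- **Liu's §4.2 datum of the UNTWISTED curve tower `M⋆`** (★ `Sec42Data.ofAlbanese`, Albanese data chosen by
★ `Albanese.nonempty_of_numberField`) — the datum on which [Liu2021, Cor. D.9] for the curve is verbatim.
[cite: Liu2021, §4.2 (l. 2053–2074) and App. C Def. C.8] -/
def sec42DataGSM (h4 : 4 ≤ Module.finrank ℚ F) (iso : ℕ → Prop) : Sec42Data (honestP5GSM F Jstar K₀ S.M) iso :=
  Sec42Data.ofAlbanese (Nat.le_of_ble_eq_true rfl) (honestSystemGSM Jstar K₀ S.M)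
    (isProjectiveOver_honestSystemGSM_Sh_iff S h4 iso) (compactifiedOfGSM S) fun K =>
      haveI := (compactifiedOfGSM S).smooth_X K
      Classical.choice
        (Albanese.nonempty_of_numberField (d := (honestP5GSM F Jstar K₀ S.M).n - 1) ((compactifiedOfGSM S).X.obj K)
          ((compactifiedOfGSM S).projective_X K))

/-- Its `X_K` is `M⋆_K` on the nose (`rfl`). [cite: Liu2021, §4.2 (l. 2062)] -/
theorem sec42DataGSM_X (h4 : 4 ≤ Module.finrank ℚ F) (iso : ℕ → Prop) (K : C5.SmallLevel K₀) :
    (sec42DataGSM S h4 iso).X K = S.M.obj K := rfl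

end HonestSystem

/-! ## §D `M⋆`'s own Hecke translates and its étale Hecke datum (honest: hypotheses u1, u4 only) -/

section HonestHeckeM

variable {F : Type} [Field F] [NumberField F] [IsCMField F] {ι₁ : F →+* ℂ} {Jstar : Matrix (Fin 2) (Fin 2) F}
  {K₀ : C5.OpenCompactSubgroup ↥(finAdelic (↥(maximalRealSubfield F)) F (IsCMField.complexConj F) 2 Jstar)}
  (S : RecordSystemGS F Jstar ι₁ K₀)

/-- `T⋆_g : M⋆_K ⟶ M⋆_{K'}` CHOSEN from u1 `S.HeckeTranslateDefinedOver` (mirror of ★ `heckeTranslatesOf`).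
[cite: Milne2005ShimuraVarieties, Thm. 13.6 p. 118] [cite: Deligne1979ShimuraVarieties, 2.1.4] -/
def recordHeckeTranslateGS (hU7ₛ : S.HeckeTranslateDefinedOver)
    (g : ↥(finAdelic (↥(maximalRealSubfield F)) F (IsCMField.complexConj F) 2 Jstar)) (K K' : C5.SmallLevel K₀)
    (hK : C5.HeckeLE g K K') : S.M.obj K ⟶ S.M.obj K' :=
  (hU7ₛ g K K' hK).choose

/-- The chosen morphism IS a Hecke translate. [cite: Milne2005ShimuraVarieties, Thm. 13.6 p. 118] -/
theorem isHeckeTranslate_recordHeckeTranslateGS (hU7ₛ : S.HeckeTranslateDefinedOver)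
    (g : ↥(finAdelic (↥(maximalRealSubfield F)) F (IsCMField.complexConj F) 2 Jstar)) (K K' : C5.SmallLevel K₀)
    (hK : C5.HeckeLE g K K') : S.IsHeckeTranslate K K' g (recordHeckeTranslateGS S hU7ₛ g K K' hK) :=
  (hU7ₛ g K K' hK).choose_spec

/-- **Hecke translates on `honestSystemGSM`**: the record's chosen translates THEMSELVES (`recordHeckeTranslateGS`, which live on
`S.M`; ★ `heckeTranslatesGS` is their base change along `c`); the three laws by the GS-2b uniqueness lemmas
(`heckeTranslate_eq_map_of_le`, `heckeTranslate_unique`, `isHeckeTranslate_comp`, `heckeTranslate_eq_id_of_mem`) without any functor.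
[cite: Milne2005ShimuraVarieties, Thm. 13.6 p. 118] [cite: Liu2021, §4.2] -/
def heckeTranslatesGSM (hU7ₛ : S.HeckeTranslateDefinedOver) :
    IncoherentShimuraSystem.HeckeTranslates (honestSystemGSM Jstar K₀ S.M) where
  tr g K K' hK := recordHeckeTranslateGS S hU7ₛ g K K' hK
  tr_one := fun {K K'} f =>
    S.heckeTranslate_eq_map_of_le f (isHeckeTranslate_recordHeckeTranslateGS S hU7ₛ 1 K K' _)
  tr_mul := fun g g' {K K' K''} hK hK' =>
    S.heckeTranslate_unique
      (S.isHeckeTranslate_comp (isHeckeTranslate_recordHeckeTranslateGS S hU7ₛ g K K' hK)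
        (isHeckeTranslate_recordHeckeTranslateGS S hU7ₛ g' K' K'' hK'))
      (isHeckeTranslate_recordHeckeTranslateGS S hU7ₛ (g * g') K K'' (hK.mul hK'))
  tr_self := fun {K k} hk =>
    S.heckeTranslate_eq_id_of_mem hk (isHeckeTranslate_recordHeckeTranslateGS S hU7ₛ k K K _)

/-- The same on the §4.2 datum `sec42DataGSM` (Compact Case packaging ★ `.ofProjective`). [cite: Liu2021, §4.2 and App. C Def. C.8] -/
def sec42HeckeTranslatesGSM (hU7ₛ : S.HeckeTranslateDefinedOver) (h4 : 4 ≤ Module.finrank ℚ F) (iso : ℕ → Prop) :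
    (sec42DataGSM S h4 iso).HeckeTranslates :=
  (heckeTranslatesGSM S hU7ₛ).ofProjective (Nat.le_of_ble_eq_true rfl) (isProjectiveOver_honestSystemGSM_Sh_iff S h4 iso)
    (smooth_honestSystemGSM_Sh S) (projective_honestSystemGSM_Sh S) _

/-- Its translate IS the chosen record translate (`rfl`). [cite: Liu2021, §4.2] -/
theorem sec42HeckeTranslatesGSM_tr (hU7ₛ : S.HeckeTranslateDefinedOver) (h4 : 4 ≤ Module.finrank ℚ F) (iso : ℕ → Prop)
    (g : ↥(finAdelic (↥(maximalRealSubfield F)) F (IsCMField.complexConj F) 2 Jstar)) (K K' : C5.SmallLevel K₀)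
    (hK : C5.HeckeLE g K K') :
    (sec42HeckeTranslatesGSM S hU7ₛ h4 iso).tr g K K' hK = recordHeckeTranslateGS S hU7ₛ g K K' hK := rfl

/-- **(I) for the UNTWISTED curve tower**: every `Alb_{u^{K'}_K} = (sec42DataGSM S h4 iso).Atr f` is an epimorphism —
★ `Sec42Data.epi_Atr_of_pieces_lift` fed DIRECTLY with ★ `RecordSystemGS.pieces_pair_lift` (no comparison isomorphism: the complex
fibre is `M_K ⊗_{ι₁} ℂ` itself). [cite: Liu2021, §4.2 (surjectivity of the Albanese transitions) and proof of Thm. 4.15]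
[cite: Deligne1979ShimuraVarieties, 2.7.1 (c)] -/
theorem albTransitionEpi_GSM (h4 : 4 ≤ Module.finrank ℚ F) (iso : ℕ → Prop) ⦃K K' : C5.SmallLevel K₀⦄ (f : K' ⟶ K) :
    Epi ((sec42DataGSM S h4 iso).Atr f) := by
  letI : Algebra F ℂ := ι₁.toAlgebra
  obtain ⟨κ, κ', P, P', inj, hP, hcol, inj', hP', hl⟩ := S.pieces_pair_lift f
  haveI := hP
  haveI := hP'
  exact (sec42DataGSM S h4 iso).epi_Atr_of_pieces_lift f inj hcol inj' hl

/-- **The `hI` binder of ★ `etaleHeckeDatumOfTranslates` for the untwisted curve tower**: the dual of `V_ℓ(Alb_{u^{K'}_K})` is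
injective (★ `AbelianVariety.injective_dualMap_rationalTateModuleMap_of_epi` ∘ `albTransitionEpi_GSM`).
[cite: Liu2021, §4.2 and App. C (the étale `H¹` of the Albanese tower)] -/
theorem hI_GSM (h4 : 4 ≤ Module.finrank ℚ F) (iso : ℕ → Prop) (ℓ : ℕ) [Fact ℓ.Prime] ⦃K K' : C5.SmallLevel K₀⦄ (f : K' ⟶ K) :
    Function.Injective (AbelianVariety.rationalTateModuleMap ℓ ((sec42DataGSM S h4 iso).Atr f)).dualMap :=
  haveI := albTransitionEpi_GSM S h4 iso f
  AbelianVariety.injective_dualMap_rationalTateModuleMap_of_epi ℓ _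

/-- **`u^N_K : M⋆_N ⟶ M⋆_K` is the quotient of `M⋆_N` by the translates `T_k`, `k ∈ K`, for separated test objects**, granted u4 —
the record level of ★ `levelQuotientUP_GS` ALONE (every translate is THE chosen one by ★ `heckeTranslate_unique`), no base change.
[cite: Deligne1979ShimuraVarieties, 2.7.1 (b)–(c)] [cite: Milne2005ShimuraVarieties, Rem. 5.29 (c) p. 65] -/
theorem levelQuotientUP_GSM (hU7ₛ : S.HeckeTranslateDefinedOver) (hLQ : S.IsLevelQuotient) (h4 : 4 ≤ Module.finrank ℚ F)
    (isoₛ : ℕ → Prop) ⦃N K : C5.SmallLevel K₀⦄ (hNK : N ≤ K) (hn : ∀ k ∈ K.1.1, C5.HeckeLE k N N)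
    (W : SchemeOver F) (f : (sec42DataGSM S h4 isoₛ).X N ⟶ W) (hW : IsSeparated W.hom)
    (hf : ∀ (k : ↥(finAdelic (↥(maximalRealSubfield F)) F (IsCMField.complexConj F) 2 Jstar)) (hk : k ∈ K.1.1),
      (sec42HeckeTranslatesGSM S hU7ₛ h4 isoₛ).tr k N N (hn k hk) ≫ f = f) :
    ∃! fbar : (sec42DataGSM S h4 isoₛ).X K ⟶ W, (sec42DataGSM S h4 isoₛ).cpt.X.map (homOfLE hNK) ≫ fbar = f := by
  obtain ⟨act, hact, hsep⟩ := hLQ hNK (fun k hk n hn' => hn k hk n hn')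
  refine hsep.2 W f hW fun k => ?_
  have hk' : ((k : ↥(finAdelic (↥(maximalRealSubfield F)) F (IsCMField.complexConj F) 2 Jstar))⁻¹) ∈ K.1.1 :=
    K.1.1.inv_mem k.2
  rw [S.heckeTranslate_unique (hact k)
    (isHeckeTranslate_recordHeckeTranslateGS S hU7ₛ
      ((k : ↥(finAdelic (↥(maximalRealSubfield F)) F (IsCMField.complexConj F) 2 Jstar))⁻¹) N N (hn _ hk'))]
  exact hf _ hk'

/-- **(D) `IsogenyDescent` for the untwisted curve tower, from u4 ALONE** (★ `isogenyDescent_of_levelQuotient_holds`).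
[cite: Liu2021, App. C (isogeny descent along the tower)] [cite: Deligne1979ShimuraVarieties, 2.7.1 (c)] -/
theorem isogenyDescent_GSM (hU7ₛ : S.HeckeTranslateDefinedOver) (hLQ : S.IsLevelQuotient) (h4 : 4 ≤ Module.finrank ℚ F)
    (isoₛ : ℕ → Prop) : (sec42HeckeTranslatesGSM S hU7ₛ h4 isoₛ).IsogenyDescent :=
  (sec42HeckeTranslatesGSM S hU7ₛ h4 isoₛ).isogenyDescent_of_levelQuotient_holds (levelQuotientUP_GSM S hU7ₛ hLQ h4 isoₛ)

/-- **The étale Hecke datum of the UNTWISTED curve tower induced by ITS OWN translates** — ★ `etaleHeckeDatumOfTranslates` at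
`hI := hI_GSM` and `hD := isogenyDescent_GSM`; hypotheses exactly {u1 `hU7ₛ`, u4 `hLQ`}; nothing transported through `X⋆`.
[cite: Liu2021, §4.2 and App. C (the étale `H¹` of the Albanese tower with its Hecke action)] -/
def etaleHeckeDatumGSM (hU7ₛ : S.HeckeTranslateDefinedOver) (hLQ : S.IsLevelQuotient) (h4 : 4 ≤ Module.finrank ℚ F)
    (isoₛ : ℕ → Prop) (ℓ : ℕ) [Fact ℓ.Prime] : (sec42DataGSM S h4 isoₛ).EtaleHeckeDatum ℓ :=
  (sec42HeckeTranslatesGSM S hU7ₛ h4 isoₛ).etaleHeckeDatumOfTranslates ℓ (hI_GSM S h4 isoₛ ℓ)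
    (isogenyDescent_GSM S hU7ₛ hLQ h4 isoₛ)

/-- It IS induced by `M⋆`'s translates (★ `isInducedBy_etaleHeckeDatumOfTranslates`). [cite: Liu2021, §4.2 and App. C] -/
theorem isInducedBy_etaleHeckeDatumGSM (hU7ₛ : S.HeckeTranslateDefinedOver) (hLQ : S.IsLevelQuotient)
    (h4 : 4 ≤ Module.finrank ℚ F) (isoₛ : ℕ → Prop) (ℓ : ℕ) [Fact ℓ.Prime] :
    (etaleHeckeDatumGSM S hU7ₛ hLQ h4 isoₛ ℓ).IsInducedBy (sec42HeckeTranslatesGSM S hU7ₛ h4 isoₛ) :=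
  (sec42HeckeTranslatesGSM S hU7ₛ h4 isoₛ).isInducedBy_etaleHeckeDatumOfTranslates ℓ (hI_GSM S h4 isoₛ ℓ)
    (isogenyDescent_GSM S hU7ₛ hLQ h4 isoₛ)

/-- Its Hecke action is ★ `etHeckeRep` of `M⋆`'s translates (`rfl`). [cite: Liu2021, §4.2 (FJcycle.tex l. 2160)] -/
theorem rhoEt_etaleHeckeDatumGSM (hU7ₛ : S.HeckeTranslateDefinedOver) (hLQ : S.IsLevelQuotient)
    (h4 : 4 ≤ Module.finrank ℚ F) (isoₛ : ℕ → Prop) (ℓ : ℕ) [Fact ℓ.Prime] :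
    (etaleHeckeDatumGSM S hU7ₛ hLQ h4 isoₛ ℓ).rhoEt = (sec42HeckeTranslatesGSM S hU7ₛ h4 isoₛ).etHeckeRep ℓ := rfl


end HonestHeckeM

end Literature.NumberTheory.Automorphic.Liu2021.AppendixC

end
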